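import Summits.Ventures.CertifiedManyBodySolver.Upper.StripCellWords

/-!
# The open Hubbard strip in column-major order, II′: the inter-cell Jordan–Wigner words of the DIAGONAL bonds

HONEST FRAMING: first certified bounds; not a superconductivity verdict; every number certified or
labelled float. NO NUMBER IS CLAIMED HERE (producer-free operator identities).

Venture `Ventures/CertifiedManyBodySolver` (sr-mbsolver), the `t′`-general strip-cell transport theorem (VAR item
V13), PART 2/5 (part 1: `Upper/StripCellsDiag.lean`). `Upper/StripCellWords.lean` computes the two halves of the
hopping word of the HORIZONTAL inter-cell bond `((c-1, y₀) of cell b) — ((0, y₀) of cell b+1)`. A DIAGONAL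
inter-cell bond joins `(c-1, y₀)` of cell `b` to `(0, y₁)` of cell `b + 1` with `|y₀ − y₁| = 1`; in the column-major
Jordan–Wigner order its string covers the later rows `y₀ < y` of the last column of cell `b` and the earlier rows
`y < y₁` of the first column of cell `b + 1` — so its LEFT half depends on `y₀` only and is the SAME
`interLeftFamily hc y₀ …` as for the horizontal bond, and its RIGHT half depends on `y₁` only and is
`interRightFamily hc y₁ …`. This file records exactly that, for an arbitrary pair of rows `(y₀, y₁)`:

* `jwWordFamily_inter₂_left/_right` (forward hop), `jwWordFamily_inter₂_left'/_right'` (backward hop),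
  `jwWordFamily_inter₂_eq_one` (trivial off the two cells);
* **`superOp_productOp_jwWordFamily_inter₂` / `_inter₂'`** — a two-row inter-cell word blocks to
  `onSite b (superSite L_{y₀}) * onSite b' (superSite R_{y₁})` on the cell chain.

At `y₁ = y₀` these are the lemmas of part II verbatim. Part 3 (`Upper/StripCellHamiltonianTTPrime.lean`) assembles
the blocked `t–t′` Hamiltonian. References: Essler et al. (2005) §12.3.4 eqs. (12.198)–(12.201) [EsslerEtAl2005];
LeBlanc et al., PRX 5 (2015) 041041, eq. (1) [LeBlancEtAl2015].
-/

noncomputable section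

open Matrix Finset
open scoped ComplexOrder BigOperators Kronecker

namespace Summit.Ventures.CertifiedManyBodySolver.Upper

open Literature.MathematicalPhysics.QuantumLattice
open Literature.MathematicalPhysics.QuantumLattice.JordanWigner

/-! ### The two-row inter-cell hopping words -/

section InterWordsTwoRows

variable {C c W Q : ℕ}

/-- **The forward two-row inter-cell word on the left cell** (`b + 1 = b'`, bond
`((c-1, y₀) of b) → ((0, y₁) of b')`): restricted to cell `b`, the family of `A_x · F_x ⋯ F · B_y` is
`interLeftFamily hc y₀ (A F)` — it depends on the left row `y₀` only. -/
theorem jwWordFamily_inter₂_left (hc : 0 < c) {b b' : Fin C} (hbb' : (b : ℕ) + 1 = b') (y₀ y₁ : Fin W)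
    (A B : Matrix (Fin 4) (Fin 4) ℂ) (f : Fin c ×ₗ Fin W) :
    jwWordFamily ((stripCells C c W).symm (b, toLex (⟨c - 1, by omega⟩, y₀)))
        ((stripCells C c W).symm (b', toLex (⟨0, hc⟩, y₁))) A B ((stripCells C c W).symm (b, f)) =
      interLeftFamily hc y₀ (A * siteParity) f := by
  have hb : b < b' := by rw [Fin.lt_def]; omega
  have hxy := stripCells_symm_lt_of_lt hb (toLex (⟨c - 1, by omega⟩, y₀)) (toLex ((⟨0, hc⟩ : Fin c), y₁))
  have hzy := stripCells_symm_lt_of_lt hb f (toLex ((⟨0, hc⟩ : Fin c), y₁))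
  rw [jwWordFamily_apply_of_ne_right hzy.ne, stringFamily_self_left hxy, stringFamily_of_lt hxy]
  obtain ⟨⟨j, y⟩, rfl⟩ := toLex.surjective f
  unfold interLeftFamily
  simp only [stripCells_symm_eq_iff, stripCells_symm_le_iff, true_and, hzy, and_true, ofLex_toLex,
    toLex_inj, Prod.mk.injEq, Prod.Lex.toLex_le_toLex]
  by_cases hj : j = ⟨c - 1, by omega⟩
  · subst hj
    by_cases hy : y = y₀
    · subst hy; simp
    · have hy' : ¬ ((⟨c - 1, by omega⟩ : Fin c) < ⟨c - 1, by omega⟩) := lt_irrefl _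
      simp only [hy, and_false, if_false, hy', false_or, true_and, if_true]
      by_cases hlt : y₀ < y
      · rw [if_pos hlt.le, if_pos hlt]
      · rw [if_neg hlt, if_neg]
        intro hle
        exact hlt (lt_of_le_of_ne hle (Ne.symm hy))
  · have hj' : ¬ ((⟨c - 1, by omega⟩ : Fin c) < j) := by
      rw [Fin.lt_def]; have := j.isLt; dsimp only; omega
    have hj'' : ¬ ((⟨c - 1, by omega⟩ : Fin c) = j) := fun h => hj h.symm
    simp only [hj, false_and, if_false, hj', hj'', false_or]

/-- **The forward two-row inter-cell word on the right cell**: restricted to cell `b'`, the family is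
`interRightFamily hc y₁ B` — it depends on the right row `y₁` only. -/
theorem jwWordFamily_inter₂_right (hc : 0 < c) {b b' : Fin C} (hbb' : (b : ℕ) + 1 = b') (y₀ y₁ : Fin W)
    (A B : Matrix (Fin 4) (Fin 4) ℂ) (f : Fin c ×ₗ Fin W) :
    jwWordFamily ((stripCells C c W).symm (b, toLex (⟨c - 1, by omega⟩, y₀)))
        ((stripCells C c W).symm (b', toLex (⟨0, hc⟩, y₁))) A B ((stripCells C c W).symm (b', f)) =
      interRightFamily hc y₁ B f := by
  have hb : b < b' := by rw [Fin.lt_def]; omega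
  have hxy := stripCells_symm_lt_of_lt hb (toLex (⟨c - 1, by omega⟩, y₀)) (toLex ((⟨0, hc⟩ : Fin c), y₁))
  have hxz := stripCells_symm_lt_of_lt hb (toLex (⟨c - 1, by omega⟩, y₀)) f
  rw [jwWordFamily_apply_of_ne_left hxz.ne', stringFamily_self_right hxy, Matrix.one_mul,
    stringFamily_of_lt hxy]
  obtain ⟨⟨j, y⟩, rfl⟩ := toLex.surjective f
  unfold interRightFamily
  simp only [stripCells_symm_eq_iff, stripCells_symm_lt_iff, true_and, hxz.le, ofLex_toLex, toLex_inj,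
    Prod.mk.injEq, Prod.Lex.toLex_lt_toLex]
  by_cases hj : j = ⟨0, hc⟩
  · subst hj
    by_cases hy : y = y₁
    · subst hy; simp
    · have hy' : ¬ ((⟨0, hc⟩ : Fin c) < ⟨0, hc⟩) := lt_irrefl _
      simp only [hy, and_false, if_false, hy', false_or, true_and, if_true]
      exact if_congr Iff.rfl rfl rfl
  · have hj' : ¬ (j < (⟨0, hc⟩ : Fin c)) := by rw [Fin.lt_def]; simp
    simp only [hj, false_and, if_false, hj', false_or]

/-- **The backward two-row inter-cell word on the left cell** (bond `((0, y₁) of b') → ((c-1, y₀) of b)`):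
restricted to cell `b`, the family of `A_y · F_y ⋯ F_x · B_x` is `interLeftFamily hc y₀ (F B)`. -/
theorem jwWordFamily_inter₂_left' (hc : 0 < c) {b b' : Fin C} (hbb' : (b : ℕ) + 1 = b') (y₀ y₁ : Fin W)
    (A B : Matrix (Fin 4) (Fin 4) ℂ) (f : Fin c ×ₗ Fin W) :
    jwWordFamily ((stripCells C c W).symm (b', toLex (⟨0, hc⟩, y₁)))
        ((stripCells C c W).symm (b, toLex (⟨c - 1, by omega⟩, y₀))) A B ((stripCells C c W).symm (b, f)) =
      interLeftFamily hc y₀ (siteParity * B) f := by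
  have hb : b < b' := by rw [Fin.lt_def]; omega
  have hxy := stripCells_symm_lt_of_lt hb (toLex (⟨c - 1, by omega⟩, y₀)) (toLex ((⟨0, hc⟩ : Fin c), y₁))
  have hzy := stripCells_symm_lt_of_lt hb f (toLex ((⟨0, hc⟩ : Fin c), y₁))
  rw [jwWordFamily_apply_of_ne_left hzy.ne, stringFamily_comm, stringFamily_self_left hxy,
    stringFamily_of_lt' hxy]
  obtain ⟨⟨j, y⟩, rfl⟩ := toLex.surjective f
  unfold interLeftFamily
  simp only [stripCells_symm_eq_iff, stripCells_symm_le_iff, true_and, hzy, and_true, ofLex_toLex,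
    toLex_inj, Prod.mk.injEq, Prod.Lex.toLex_le_toLex]
  by_cases hj : j = ⟨c - 1, by omega⟩
  · subst hj
    by_cases hy : y = y₀
    · subst hy; simp
    · have hy' : ¬ ((⟨c - 1, by omega⟩ : Fin c) < ⟨c - 1, by omega⟩) := lt_irrefl _
      simp only [hy, and_false, if_false, hy', false_or, true_and, if_true]
      by_cases hlt : y₀ < y
      · rw [if_pos hlt.le, if_pos hlt]
      · rw [if_neg hlt, if_neg]
        intro hle
        exact hlt (lt_of_le_of_ne hle (Ne.symm hy))
  · have hj' : ¬ ((⟨c - 1, by omega⟩ : Fin c) < j) := by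
      rw [Fin.lt_def]; have := j.isLt; dsimp only; omega
    have hj'' : ¬ ((⟨c - 1, by omega⟩ : Fin c) = j) := fun h => hj h.symm
    simp only [hj, false_and, if_false, hj', hj'', false_or]

/-- **The backward two-row inter-cell word on the right cell**: restricted to cell `b'`, the family is
`interRightFamily hc y₁ A`. -/
theorem jwWordFamily_inter₂_right' (hc : 0 < c) {b b' : Fin C} (hbb' : (b : ℕ) + 1 = b') (y₀ y₁ : Fin W)
    (A B : Matrix (Fin 4) (Fin 4) ℂ) (f : Fin c ×ₗ Fin W) :
    jwWordFamily ((stripCells C c W).symm (b', toLex (⟨0, hc⟩, y₁)))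
        ((stripCells C c W).symm (b, toLex (⟨c - 1, by omega⟩, y₀))) A B ((stripCells C c W).symm (b', f)) =
      interRightFamily hc y₁ A f := by
  have hb : b < b' := by rw [Fin.lt_def]; omega
  have hxy := stripCells_symm_lt_of_lt hb (toLex (⟨c - 1, by omega⟩, y₀)) (toLex ((⟨0, hc⟩ : Fin c), y₁))
  have hxz := stripCells_symm_lt_of_lt hb (toLex (⟨c - 1, by omega⟩, y₀)) f
  rw [jwWordFamily_apply_of_ne_right hxz.ne', stringFamily_comm, stringFamily_self_right hxy,
    Matrix.mul_one, stringFamily_of_lt' hxy]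
  obtain ⟨⟨j, y⟩, rfl⟩ := toLex.surjective f
  unfold interRightFamily
  simp only [stripCells_symm_eq_iff, stripCells_symm_lt_iff, true_and, hxz.le, ofLex_toLex, toLex_inj,
    Prod.mk.injEq, Prod.Lex.toLex_lt_toLex]
  by_cases hj : j = ⟨0, hc⟩
  · subst hj
    by_cases hy : y = y₁
    · subst hy; simp
    · have hy' : ¬ ((⟨0, hc⟩ : Fin c) < ⟨0, hc⟩) := lt_irrefl _
      simp only [hy, and_false, if_false, hy', false_or, true_and, if_true]
      exact if_congr Iff.rfl rfl rfl
  · have hj' : ¬ (j < (⟨0, hc⟩ : Fin c)) := by rw [Fin.lt_def]; simp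
    simp only [hj, false_and, if_false, hj', false_or]

/-- A two-row inter-cell word is trivial off the two cells it joins. -/
theorem jwWordFamily_inter₂_eq_one (hc : 0 < c) {b b' : Fin C} (hbb' : (b : ℕ) + 1 = b') (y₀ y₁ : Fin W)
    (A B : Matrix (Fin 4) (Fin 4) ℂ) {z : Fin (C * c) ×ₗ Fin W} (hz : (stripCells C c W z).1 ≠ b)
    (hz' : (stripCells C c W z).1 ≠ b') :
    jwWordFamily ((stripCells C c W).symm (b, toLex (⟨c - 1, by omega⟩, y₀)))
        ((stripCells C c W).symm (b', toLex (⟨0, hc⟩, y₁))) A B z = 1 ∧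
      jwWordFamily ((stripCells C c W).symm (b', toLex (⟨0, hc⟩, y₁)))
        ((stripCells C c W).symm (b, toLex (⟨c - 1, by omega⟩, y₀))) A B z = 1 := by
  have hb : b < b' := by rw [Fin.lt_def]; omega
  have hxy := stripCells_symm_lt_of_lt hb (toLex (⟨c - 1, by omega⟩, y₀)) (toLex ((⟨0, hc⟩ : Fin c), y₁))
  have hzx : z ≠ (stripCells C c W).symm (b, toLex (⟨c - 1, by omega⟩, y₀)) := by
    rintro rfl; exact hz (by rw [Equiv.apply_symm_apply])
  have hzy : z ≠ (stripCells C c W).symm (b', toLex (⟨0, hc⟩, y₁)) := by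
    rintro rfl; exact hz' (by rw [Equiv.apply_symm_apply])
  have hstr : stringFamily ((stripCells C c W).symm (b, toLex (⟨c - 1, by omega⟩, y₀)))
      ((stripCells C c W).symm (b', toLex (⟨0, hc⟩, y₁))) z = 1 := by
    rw [stringFamily_of_lt hxy, if_neg]
    rintro ⟨h₁, h₂⟩
    rcases stripCells_fst_of_between hbb' _ _ h₁ h₂.le with h | h
    · exact hz h
    · exact hz' h
  constructor
  · rw [jwWordFamily_apply_of_ne_right hzy, if_neg hzx, hstr]
  · rw [jwWordFamily_apply_of_ne_right hzx, if_neg hzy, stringFamily_comm, hstr]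

/-- **Blocking the forward two-row inter-cell word**: `superOp (A_x · F ⋯ F · B_y) = (L)_b (R)_{b'}` with
`L = superSite (⨂ interLeftFamily y₀ (A F))`, `R = superSite (⨂ interRightFamily y₁ B)`. -/
theorem superOp_productOp_jwWordFamily_inter₂ (hc : 0 < c) (κ : TensorIndex (Fin c ×ₗ Fin W) 4 ≃ Fin Q)
    {b b' : Fin C} (hbb' : (b : ℕ) + 1 = b') (y₀ y₁ : Fin W) (A B : Matrix (Fin 4) (Fin 4) ℂ) :
    superOp (stripCells C c W) κ (productOp (jwWordFamily
        ((stripCells C c W).symm (b, toLex (⟨c - 1, by omega⟩, y₀)))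
        ((stripCells C c W).symm (b', toLex (⟨0, hc⟩, y₁))) A B)) =
      onSite b (superSite κ (productOp (interLeftFamily hc y₀ (A * siteParity)))) *
        onSite b' (superSite κ (productOp (interRightFamily hc y₁ B))) := by
  have hne : b ≠ b' := fun h => by rw [Fin.ext_iff] at h; omega
  rw [superOp_productOp_of_support₂ (stripCells C c W) κ _ hne
    (fun z hz hz' => (jwWordFamily_inter₂_eq_one hc hbb' y₀ y₁ A B hz hz').1)]
  simp only [jwWordFamily_inter₂_left hc hbb', jwWordFamily_inter₂_right hc hbb']

/-- **Blocking the backward two-row inter-cell word**: `superOp (A_y · F ⋯ F · B_x) = (L')_b (R')_{b'}` with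
`L' = superSite (⨂ interLeftFamily y₀ (F B))`, `R' = superSite (⨂ interRightFamily y₁ A)`. -/
theorem superOp_productOp_jwWordFamily_inter₂' (hc : 0 < c) (κ : TensorIndex (Fin c ×ₗ Fin W) 4 ≃ Fin Q)
    {b b' : Fin C} (hbb' : (b : ℕ) + 1 = b') (y₀ y₁ : Fin W) (A B : Matrix (Fin 4) (Fin 4) ℂ) :
    superOp (stripCells C c W) κ (productOp (jwWordFamily
        ((stripCells C c W).symm (b', toLex (⟨0, hc⟩, y₁)))
        ((stripCells C c W).symm (b, toLex (⟨c - 1, by omega⟩, y₀))) A B)) =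
      onSite b (superSite κ (productOp (interLeftFamily hc y₀ (siteParity * B)))) *
        onSite b' (superSite κ (productOp (interRightFamily hc y₁ A))) := by
  have hne : b ≠ b' := fun h => by rw [Fin.ext_iff] at h; omega
  rw [superOp_productOp_of_support₂ (stripCells C c W) κ _ hne
    (fun z hz hz' => (jwWordFamily_inter₂_eq_one hc hbb' y₀ y₁ A B hz hz').2)]
  simp only [jwWordFamily_inter₂_left' hc hbb', jwWordFamily_inter₂_right' hc hbb']

end InterWordsTwoRows

end Summit.Ventures.CertifiedManyBodySolver.Upper

end
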